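import Summits.QuantumFields.BalabanUV.T4Continuum.Support.NE7AccumulatedFrameDefectLocal
import Summits.QuantumFields.BalabanUV.T4Continuum.Spine.NE3.RemainderTowerLevelsB8
import HarnessLib

/-!
# Support | NE7 (gen 97, ROAD-G97 §3: (Γ3) SUMMED OVER THE TOP CORNERS, ℓ² FORM): the corner blocks of every level are disjoint inside that level's period box, so the block
# energies of the path functionals of `NE7AccumulatedFrameDefectLocal` sum, over the `N^d` top corners, to row NE3's GLOBAL ℓ² tower letter —
# `Σ_{z∈[0,N)^d} SQ_m(z) ≤ 16·dL·(L²∕L^d)^m · l2sq X` (every level `m ≤ j`) and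
# `Σ_{z∈[0,N)^d} ‖log v_{j+1}(z) − Σ_{m≤j} frameLin L W̄^m ψ_m (L^{j+1−m}z)‖² ≤ 4096·d³L⁵·b²·L^{j+1}·(Σ_{m≤j} L^m(L²∕L^d)^m)·l2sq X` — N-FREE, k-FREE up to the displayed level sum (`≤ 2` in d = 4)

Cell `pub-balaban`, rung (B)+1 sub-cell t4, lineage `b2b-balaban-t4-ne7-p1` (CRUX PROVER NE7 #1 = OWNER of row NE7), generation 97; memo `t4/b2b-balaban-t4-ne7-p1-g97/ROAD-G97.md` §3.
Over this generation's `NE7AccumulatedFrameDefectLocal` (product form `3(ΣPA)² + 2ΣSQ`, sup-capped form `16dL²b·Σ_m L^m PA_m`, Jensen `PA² ≤ SQ ≤ dL·(block energy)`), row NE3's ℓ²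
tower letter `RemainderTowerLevelsB8.sqrt_l2sq_logCovIter_le` (`√l2sq_{[0,N·L^{j+1−i})^d}(Q_i) ≤ 4(√(L²∕L^d))^i·√l2sq X`, every level `i ≤ j+1`), and the substrate's block tiling
`T4AveragingDeficitWallBoundary.sum_blocks_eq` ∕ `blockSites_periodBox`.

WHY (memo ROAD-G97 §§2–3).  The ν-letter of the binder `hdecomp♭` books the top pure gauge's second-order parameter through the ℓ² sum over the top corners of `h_z²`; by the
product form this is a corner sum of squares of honest path-averages of the nonlinear level fields `ψ_m`, each bounded by the energy of `ψ_m` on the level-`m` block at the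
corner-chain point `L^{j+1−m}z`.  These blocks, for distinct top corners `z`, are DISJOINT inside the level-`m` period box `[0, N·L^{j+1−m})^d` (spacing `L^{j+1−m} ≥ L` = block
side), so the corner sum is at most the global `l2sq` of `ψ_m` = of `Q_m` (unitary frames), which row NE3 bounds by `16(L²∕L^d)^m·l2sq X` — with NO factor of the number of corners.
With the explicit weights `L^m` of the sup-capped form the level sum is geometric (`Σ_m L^m(L²∕L^d)^m ≤ 2` in d = 4): in d = 4 the display reads `Σ_z h_z² ≤ 8192·d³L⁵·(Mb)²·M⁻¹·‖X‖²_{ℓ²}`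
(`M = L^{j+1}`), i.e. `≤ C·α̂²·M·E_w(X)²` — against the weight `M⁻²` of a corner spike's energy this is the k-free (indeed `M⁻¹`-small) ν-cost of carrying the parameter as a fine pure
gauge (memo §3).  The ℓ¹-type letters need the product form summed WITHOUT squaring (memo §3, successor).
WHAT ([folklore]; 0 def, 0 sorry).  §1 `sum_boxVec_le_sum_boxVec_of_le` (a sub-block sum is at most the block sum, `g ≥ 0`), `sum_periodBox_cornerBlocks_le`
(`Σ_{z∈[0,N)^d}Σ_{v∈[0,L)^d} g(P•z + v) ≤ Σ_{w∈[0,P·N)^d} g(w)` for `L ≤ P`, `g ≥ 0`).  §2 **`sum_corners_sqAvg_le`** (the first display, in the tower class at `W`).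
§3 **`sum_corners_normSq_defect_le`** (the second display).
HONEST FRAMING (page 1): counting and bookkeeping on OUR frame over landed kernel theorems; nothing of Bałaban's asserted; the ℓ¹ corner letters, (Γ4), (Γ5), `hdecomp♭`, NE7 NOT proved;
spine 0∕9; finite T⁴ rung (B)+1 — NOT infinite volume, NOT mass gap, NOT `BetaPertH`, NOT Clay.  Continuum YM on T⁴ ⇐ BetaPertH ∧ nine spine estimates (0/9 proved); BetaPertH ⇐ (D1) ∧
(D4) ∧ CAP+tail; G-an2-4 gates asym, D1 and NE2/3/4.
-/

set_option autoImplicit false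

open scoped BigOperators Matrix Matrix.Norms.L2Operator
open NormedSpace Finset

namespace Summit.QuantumFields.BalabanUV.T4Continuum.NE7AccumulatedFrameDefectCornerSums

open Literature.MathematicalPhysics.QuantumFieldTheory.Balaban1983to89
open B7Prop1Explicit B7Prop2Explicit B7Prop3Flat MatrixLog
open B7Eq92Concrete (vcov)
open B7Prop4GeneralLevels (logCovIter)
open T4AveragingDeficitWall (Ad IsUnitaryCfg SmallField)
open T4AveragingDeficitWallBoundary (IsPeriodicCfg periodBox mem_periodBox sum_blocks_eq blockSites_periodBox)
open AveragingDeficitPeriodicCounting (IsPeriodicDir)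
open AveragingDeficitTransport (lnorm norm_Ad_of_unitary)
open AveragingDeficitNearIdentity (lnorm_nonneg)
open AveragingDeficitMultiLevelPrep (LevelSmall)
open BlockAveragePushDirSplit (frameLin)
open NE3.QbarDictionary (adField)
open NE3.PairLandauB8Avg (relPert)
open NE3CovariantLineSumsL2 (l2sq l2sq_nonneg)
open ShellMeasureAverageProp4General (C1cov)
open NE3.RemainderTowerLevelsB8 (sqrt_l2sq_logCovIter_le)
open NE7AccumulatedFrameDictionary (sum_pow_le_pow level_dictionary)
open NE7AccumulatedFrameDefectLocal (pathAvg_sq_le_sqAvg sqAvg_le_blockEnergy norm_mlog_vcov_sub_sum_frameLin_le_supCapped)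

noncomputable section

variable {d : ℕ} {n : Type*} [Fintype n] [DecidableEq n]

/-! ## §1 Counting: sub-blocks and the disjointness of the corner blocks inside a level's period box -/

omit [Fintype n] [DecidableEq n] in
/-- A sub-block sum is at most the block sum: for `L ≤ P` and `g ≥ 0`, `Σ_{r∈[0,L)^d} g(c + r) ≤ Σ_{r′∈[0,P)^d} g(c + r′)`. [folklore] -/
theorem sum_boxVec_le_sum_boxVec_of_le {L P : ℕ} (hLP : L ≤ P) {g : Site d → ℝ} (hg : ∀ x, 0 ≤ g x) (c : Site d) :
    ∑ r : Fin d → Fin L, g (c + boxVec L r) ≤ ∑ r' : Fin d → Fin P, g (c + boxVec P r') := by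
  classical
  -- the embedding of the small block into the big one
  let ι : (Fin d → Fin L) → (Fin d → Fin P) := fun r κ => Fin.castLE hLP (r κ)
  have hι : ∀ r, boxVec P (ι r) = boxVec L r := fun r => funext fun κ => by simp [boxVec, ι]
  have hinj : Function.Injective ι := fun r r' h => funext fun κ => by
    have := congrFun h κ
    exact Fin.castLE_injective hLP this
  have himg : ∑ r' ∈ (Finset.univ : Finset (Fin d → Fin L)).image ι, g (c + boxVec P r')
      = ∑ r : Fin d → Fin L, g (c + boxVec P (ι r)) :=
    Finset.sum_image (f := fun r' => g (c + boxVec P r')) fun a _ b _ h => hinj h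
  calc ∑ r : Fin d → Fin L, g (c + boxVec L r)
      = ∑ r : Fin d → Fin L, g (c + boxVec P (ι r)) := Finset.sum_congr rfl fun r _ => by rw [hι]
    _ = ∑ r' ∈ (Finset.univ : Finset (Fin d → Fin L)).image ι, g (c + boxVec P r') := himg.symm
    _ ≤ ∑ r' : Fin d → Fin P, g (c + boxVec P r') :=
        Finset.sum_le_sum_of_subset_of_nonneg (Finset.subset_univ _) fun r' _ _ => hg _

omit [Fintype n] [DecidableEq n] in
/-- **THE CORNER BLOCKS ARE DISJOINT IN THE PERIOD BOX**: for `1 ≤ L ≤ P` and `g ≥ 0`, `Σ_{z∈[0,N)^d} Σ_{v∈[0,L)^d} g(P•z + v) ≤ Σ_{w∈[0,P·N)^d} g(w)` (the blocks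
`P•z + [0,P)^d` tile `[0,P·N)^d`, and `[0,L)^d ⊆ [0,P)^d`). [folklore] -/
theorem sum_periodBox_cornerBlocks_le {L P : ℕ} (hL : 1 ≤ L) (hLP : L ≤ P) (N : ℕ) {g : Site d → ℝ} (hg : ∀ x, 0 ≤ g x) :
    ∑ z ∈ periodBox (d := d) N, ∑ v ∈ periodBox (d := d) L, g ((P : ℤ) • z + v) ≤ ∑ w ∈ periodBox (d := d) (P * N), g w := by
  classical
  have hP : 1 ≤ P := le_trans hL hLP
  have hbinj : Function.Injective (boxVec (d := d) L) := fun r r' h => funext fun κ => Fin.ext (by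
    have := congrFun h κ
    simpa [boxVec] using this)
  have hinner : ∀ z : Site d, ∑ v ∈ periodBox (d := d) L, g ((P : ℤ) • z + v) = ∑ r : Fin d → Fin L, g ((P : ℤ) • z + boxVec L r) := by
    intro z
    unfold periodBox
    rw [Finset.sum_image fun a _ b _ h => hbinj h]
  calc ∑ z ∈ periodBox (d := d) N, ∑ v ∈ periodBox (d := d) L, g ((P : ℤ) • z + v)
      = ∑ z ∈ periodBox (d := d) N, ∑ r : Fin d → Fin L, g ((P : ℤ) • z + boxVec L r) := Finset.sum_congr rfl fun z _ => hinner z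
    _ ≤ ∑ z ∈ periodBox (d := d) N, ∑ r' : Fin d → Fin P, g ((P : ℤ) • z + boxVec P r') :=
        Finset.sum_le_sum fun z _ => sum_boxVec_le_sum_boxVec_of_le hLP hg _
    _ = ∑ w ∈ periodBox (d := d) (P * N), g w := by rw [sum_blocks_eq P hP, blockSites_periodBox P N hP]

/-! ## §2 The corner sum of the square path functional of one level -/

/-- **CORNER SUM OF `SQ_m` AGAINST ROW NE3's ℓ² TOWER LETTER**: in the tower class at `W` (hypotheses of `RemainderTowerLevelsB8.sqrt_l2sq_logCovIter_le`), for every `m ≤ j`,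
`Σ_{z∈[0,N)^d} L^{−d}Σ_r lnorm(ψ_m; L^{j+1−m}•z, Γ_r)² ≤ 16·dL·(L²∕L^d)^m · l2sq_{[0,N·L^{j+1})^d} X`, `ψ_m = Ad_{W̄^m}⁻¹ Q_m` (Jensen on each corner block, disjointness of the corner
blocks in `[0,N·L^{j+1−m})^d`, unitary invariance, row NE3's letter squared). [folklore] -/
theorem sum_corners_sqAvg_le [Nonempty n] {L N : ℕ} (hL : 2 ≤ L) (hN : 1 ≤ N) (j : ℕ)
    {W : Site d → Fin d → (Matrix n n ℂ)ˣ} {x : ℝ} (hWu : IsUnitaryCfg W) (hWP : IsPeriodicCfg W ((N * L ^ (j + 1) : ℕ) : ℤ))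
    (hx : 0 ≤ x) (hsm : LevelSmall d L j x) (hWx : SmallField W x)
    {α₀ b : ℝ} (hα : 0 < α₀) (hα3 : C0 d * (2 * α₀) ≤ 1 / 3) (hα4 : 4 * (2 * α₀) ≤ c2' d L)
    (h52 : pdev W < α₀ * (((L : ℝ) ^ (j + 1))⁻¹) ^ 2) (hb : 0 ≤ b)
    {X : Site d → Fin d → Matrix n n ℂ} (hX : ∀ (y : Site d) (κ : Fin d), ‖X y κ‖ ≤ b) (hXP : IsPeriodicDir X ((N * L ^ (j + 1) : ℕ) : ℤ))
    (hsmall : Real.exp (4 * (800 * ((d : ℝ) + 1) ^ 2 * ((d : ℝ) + 4)) * α₀)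
      * (1 + 8 * (131072 * ((d : ℝ) + 1) ^ 2) * ((L : ℝ) ^ (j + 1) * b)) ≤ 2)
    (hc₃ : 4 * ((L : ℝ) ^ (j + 1) * b) ≤ c3 d L)
    (hK : 16 * (C1cov d * (L : ℝ) ^ 2 * Real.sqrt (d * (2 * (2 * L) + 1) ^ d)) * (L : ℝ) ^ (j + 1) * b ≤ Real.sqrt ((L : ℝ) ^ 2 / (L : ℝ) ^ d))
    {m : ℕ} (hm : m ≤ j) :
    ∑ z ∈ periodBox (d := d) N, ((L : ℝ) ^ d)⁻¹ * ∑ r : Fin d → Fin L,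
        lnorm (fun x' μ => Ad (avgIter L W m x' μ)⁻¹ (logCovIter L W (adField W X) m x' μ)) (((L : ℤ) ^ (j + 1 - m)) • z) (treeWord (boxVec L r)) ^ 2
      ≤ 16 * ((d : ℝ) * L) * ((L : ℝ) ^ 2 / (L : ℝ) ^ d) ^ m * l2sq (periodBox (d := d) (N * L ^ (j + 1))) X := by
  letI : CStarAlgebra (Matrix n n ℂ) := {}
  have hL1 : 1 ≤ L := by omega
  have hα3' : C0 d * α₀ ≤ 1 / 3 := by
    have hC : 0 ≤ C0 d := by unfold C0; positivity
    nlinarith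
  have hα4' : 4 * α₀ ≤ c2' d L := by linarith
  have hL0 : (0 : ℝ) < L := by exact_mod_cast (show 0 < L by omega)
  have hc₃' : 2 * ((L : ℝ) ^ (j + 1) * b) ≤ c3 d L := by nlinarith [pow_pos hL0 (j + 1)]
  obtain ⟨hUm, -, -, -, -⟩ := level_dictionary hL (j + 1) hWu (X := X) hα hα3' hα4' h52 hb hX hsmall hc₃' m (by omega)
  set ψ : Site d → Fin d → Matrix n n ℂ := fun x' μ => Ad (avgIter L W m x' μ)⁻¹ (logCovIter L W (adField W X) m x' μ) with hψ
  -- Jensen on each corner block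
  have hblock : ∀ z : Site d, ((L : ℝ) ^ d)⁻¹ * ∑ r : Fin d → Fin L, lnorm ψ (((L : ℤ) ^ (j + 1 - m)) • z) (treeWord (boxVec L r)) ^ 2
      ≤ ((d : ℝ) * L) * ∑ v ∈ periodBox (d := d) L, ∑ κ : Fin d, ‖ψ (((L : ℤ) ^ (j + 1 - m)) • z + v) κ‖ ^ 2 :=
    fun z => sqAvg_le_blockEnergy hL1 ψ _
  -- disjointness of the corner blocks in the level-`m` period box
  set P : ℕ := L ^ (j + 1 - m) with hPdef
  have hLP : L ≤ P := by
    rw [hPdef]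
    calc L = L ^ 1 := (pow_one L).symm
      _ ≤ L ^ (j + 1 - m) := Nat.pow_le_pow_right (by omega) (by omega)
  have hPz : ∀ z : Site d, (((L : ℤ) ^ (j + 1 - m)) • z : Site d) = (P : ℤ) • z := fun z => by rw [hPdef]; push_cast; rfl
  have htile : ∑ z ∈ periodBox (d := d) N, ∑ v ∈ periodBox (d := d) L, ∑ κ : Fin d, ‖ψ (((L : ℤ) ^ (j + 1 - m)) • z + v) κ‖ ^ 2
      ≤ ∑ w ∈ periodBox (d := d) (P * N), ∑ κ : Fin d, ‖ψ w κ‖ ^ 2 := by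
    have h := sum_periodBox_cornerBlocks_le (d := d) hL1 hLP N (g := fun w => ∑ κ : Fin d, ‖ψ w κ‖ ^ 2)
      (fun w => Finset.sum_nonneg fun κ _ => sq_nonneg _)
    refine le_trans (le_of_eq (Finset.sum_congr rfl fun z _ => Finset.sum_congr rfl fun v _ => by rw [hPz])) h
  -- unitary invariance: `‖ψ_m‖ = ‖Q_m‖` bondwise, and the period box of level `m`
  have hnorm : ∀ (w : Site d) (κ : Fin d), ‖ψ w κ‖ = ‖logCovIter L W (adField W X) m w κ‖ := fun w κ => by
    simp only [hψ]; rw [norm_Ad_of_unitary (Subgroup.inv_mem _ (hUm w κ))]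
  have hPN : P * N = N * L ^ (j + 1 - m) := by rw [hPdef, Nat.mul_comm]
  have hl2 : ∑ w ∈ periodBox (d := d) (P * N), ∑ κ : Fin d, ‖ψ w κ‖ ^ 2 = l2sq (periodBox (d := d) (N * L ^ (j + 1 - m))) (logCovIter L W (adField W X) m) := by
    rw [hPN]; unfold l2sq
    exact Finset.sum_congr rfl fun w _ => Finset.sum_congr rfl fun κ _ => by rw [hnorm]
  -- row NE3's ℓ² tower letter at level `m`, squared
  have hNE3 := sqrt_l2sq_logCovIter_le hL hN j hWu hWP hx hsm hWx hα hα3 hα4 h52 hb hX hXP hsmall hc₃ hK m (by omega)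
  set ρ : ℝ := Real.sqrt ((L : ℝ) ^ 2 / (L : ℝ) ^ d) with hρ
  have hρ2 : ρ ^ 2 = (L : ℝ) ^ 2 / (L : ℝ) ^ d := Real.sq_sqrt (by positivity)
  have hA0 : 0 ≤ l2sq (periodBox (d := d) (N * L ^ (j + 1 - m))) (logCovIter L W (adField W X) m) := l2sq_nonneg _ _
  have hB0 : 0 ≤ l2sq (periodBox (d := d) (N * L ^ (j + 1))) X := l2sq_nonneg _ _
  have hsq : l2sq (periodBox (d := d) (N * L ^ (j + 1 - m))) (logCovIter L W (adField W X) m)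
      ≤ 16 * ((L : ℝ) ^ 2 / (L : ℝ) ^ d) ^ m * l2sq (periodBox (d := d) (N * L ^ (j + 1))) X := by
    have h1 : Real.sqrt (l2sq (periodBox (d := d) (N * L ^ (j + 1 - m))) (logCovIter L W (adField W X) m)) ^ 2
        ≤ (4 * ρ ^ m * Real.sqrt (l2sq (periodBox (d := d) (N * L ^ (j + 1))) X)) ^ 2 :=
      pow_le_pow_left₀ (Real.sqrt_nonneg _) hNE3 2
    rw [Real.sq_sqrt hA0] at h1
    refine h1.trans (le_of_eq ?_)
    rw [mul_pow, mul_pow, Real.sq_sqrt hB0, ← pow_mul, mul_comm m 2, pow_mul, hρ2]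
    norm_num
  -- assemble
  calc ∑ z ∈ periodBox (d := d) N, ((L : ℝ) ^ d)⁻¹ * ∑ r : Fin d → Fin L, lnorm ψ (((L : ℤ) ^ (j + 1 - m)) • z) (treeWord (boxVec L r)) ^ 2
      ≤ ∑ z ∈ periodBox (d := d) N, ((d : ℝ) * L) * ∑ v ∈ periodBox (d := d) L, ∑ κ : Fin d, ‖ψ (((L : ℤ) ^ (j + 1 - m)) • z + v) κ‖ ^ 2 :=
        Finset.sum_le_sum fun z _ => hblock z
    _ = ((d : ℝ) * L) * ∑ z ∈ periodBox (d := d) N, ∑ v ∈ periodBox (d := d) L, ∑ κ : Fin d, ‖ψ (((L : ℤ) ^ (j + 1 - m)) • z + v) κ‖ ^ 2 := by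
        rw [Finset.mul_sum]
    _ ≤ ((d : ℝ) * L) * l2sq (periodBox (d := d) (N * L ^ (j + 1 - m))) (logCovIter L W (adField W X) m) := by
        rw [← hl2]; exact mul_le_mul_of_nonneg_left htile (by positivity)
    _ ≤ ((d : ℝ) * L) * (16 * ((L : ℝ) ^ 2 / (L : ℝ) ^ d) ^ m * l2sq (periodBox (d := d) (N * L ^ (j + 1))) X) :=
        mul_le_mul_of_nonneg_left hsq (by positivity)
    _ = 16 * ((d : ℝ) * L) * ((L : ℝ) ^ 2 / (L : ℝ) ^ d) ^ m * l2sq (periodBox (d := d) (N * L ^ (j + 1))) X := by ring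

/-! ## §3 The ℓ²-over-corners letter of the second-order frame defect -/

/-- **THE SECOND-ORDER FRAME DEFECT, SQUARED AND SUMMED OVER THE TOP CORNERS** (tower class at `W`, Prop-4 regime at the top level `j+1` with `44·dL·(L^{j+1}b) ≤ 1`):
`Σ_{z∈[0,N)^d} ‖log v_{j+1}(z) − Σ_{m≤j} frameLin L W̄^m ψ_m (L^{j+1−m}•z)‖² ≤ 4096·d³L⁵·b²·L^{j+1}·(Σ_{m≤j} L^m(L²∕L^d)^m)·l2sq X` — N-free; in d = 4 the level sum is `Σ_m L^{−m} ≤ 2`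
and the right-hand side is `8192·d³L⁵·(L^{j+1}b)²·(L^{j+1})⁻¹·‖X‖²_{ℓ²}` (sup-capped form, Cauchy–Schwarz with the weights `L^m`, Jensen, §2). [folklore] -/
theorem sum_corners_normSq_defect_le [Nonempty n] {L N : ℕ} (hL : 2 ≤ L) (hN : 1 ≤ N) (j : ℕ)
    {W : Site d → Fin d → (Matrix n n ℂ)ˣ} {x : ℝ} (hWu : IsUnitaryCfg W) (hWP : IsPeriodicCfg W ((N * L ^ (j + 1) : ℕ) : ℤ))
    (hx : 0 ≤ x) (hsm : LevelSmall d L j x) (hWx : SmallField W x)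
    {α₀ b : ℝ} (hα : 0 < α₀) (hα3 : C0 d * (2 * α₀) ≤ 1 / 3) (hα4 : 4 * (2 * α₀) ≤ c2' d L)
    (h52 : pdev W < α₀ * (((L : ℝ) ^ (j + 1))⁻¹) ^ 2) (hb : 0 ≤ b)
    {X : Site d → Fin d → Matrix n n ℂ} (hX : ∀ (y : Site d) (κ : Fin d), ‖X y κ‖ ≤ b) (hXP : IsPeriodicDir X ((N * L ^ (j + 1) : ℕ) : ℤ))
    (hsmall : Real.exp (4 * (800 * ((d : ℝ) + 1) ^ 2 * ((d : ℝ) + 4)) * α₀)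
      * (1 + 8 * (131072 * ((d : ℝ) + 1) ^ 2) * ((L : ℝ) ^ (j + 1) * b)) ≤ 2)
    (hc₃ : 4 * ((L : ℝ) ^ (j + 1) * b) ≤ c3 d L)
    (hK : 16 * (C1cov d * (L : ℝ) ^ 2 * Real.sqrt (d * (2 * (2 * L) + 1) ^ d)) * (L : ℝ) ^ (j + 1) * b ≤ Real.sqrt ((L : ℝ) ^ 2 / (L : ℝ) ^ d))
    (h44 : 44 * ((d : ℝ) * L * ((L : ℝ) ^ (j + 1) * b)) ≤ 1) :
    ∑ z ∈ periodBox (d := d) N,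
        ‖mlog ((vcov L W (relPert W X) (j + 1) z : (Matrix n n ℂ)ˣ) : Matrix n n ℂ)
          - ∑ m ∈ range (j + 1), frameLin L (avgIter L W m)
              (fun x' μ => Ad (avgIter L W m x' μ)⁻¹ (logCovIter L W (adField W X) m x' μ)) (((L : ℤ) ^ (j + 1 - m)) • z)‖ ^ 2
      ≤ 4096 * ((d : ℝ) ^ 3 * (L : ℝ) ^ 5) * b ^ 2 * (L : ℝ) ^ (j + 1)
          * (∑ m ∈ range (j + 1), (L : ℝ) ^ m * ((L : ℝ) ^ 2 / (L : ℝ) ^ d) ^ m) * l2sq (periodBox (d := d) (N * L ^ (j + 1))) X := by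
  letI : CStarAlgebra (Matrix n n ℂ) := {}
  have hL1 : 1 ≤ L := by omega
  have hLR : (2 : ℝ) ≤ L := by exact_mod_cast hL
  have hα3' : C0 d * α₀ ≤ 1 / 3 := by
    have hC : 0 ≤ C0 d := by unfold C0; positivity
    nlinarith
  have hα4' : 4 * α₀ ≤ c2' d L := by linarith
  have hL0 : (0 : ℝ) < L := by exact_mod_cast (show 0 < L by omega)
  have hc₃' : 2 * ((L : ℝ) ^ (j + 1) * b) ≤ c3 d L := by nlinarith [pow_pos hL0 (j + 1)]
  set k : ℕ := j + 1 with hk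
  set ψ : ℕ → Site d → Fin d → Matrix n n ℂ := fun m x' μ => Ad (avgIter L W m x' μ)⁻¹ (logCovIter L W (adField W X) m x' μ) with hψ
  set PA : ℕ → Site d → ℝ := fun m z => ((L : ℝ) ^ d)⁻¹ * ∑ r : Fin d → Fin L, lnorm (ψ m) (((L : ℤ) ^ (k - m)) • z) (treeWord (boxVec L r)) with hPA
  set SQ : ℕ → Site d → ℝ := fun m z => ((L : ℝ) ^ d)⁻¹ * ∑ r : Fin d → Fin L, lnorm (ψ m) (((L : ℤ) ^ (k - m)) • z) (treeWord (boxVec L r)) ^ 2 with hSQ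
  set E : ℝ := l2sq (periodBox (d := d) (N * L ^ k)) X with hE
  set ρ2 : ℝ := (L : ℝ) ^ 2 / (L : ℝ) ^ d with hρ2
  have hE0 : 0 ≤ E := l2sq_nonneg _ _
  have hρ0 : 0 ≤ ρ2 := by positivity
  have hPA0 : ∀ m z, 0 ≤ PA m z := fun m z => by
    simp only [hPA]; exact mul_nonneg (by positivity) (Finset.sum_nonneg fun r _ => lnorm_nonneg _ _ _)
  -- pointwise: the sup-capped form, then Cauchy–Schwarz with the weights `L^m`, then Jensen `PA² ≤ SQ`
  have hpt : ∀ z : Site d,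
      ‖mlog ((vcov L W (relPert W X) k z : (Matrix n n ℂ)ˣ) : Matrix n n ℂ) - ∑ m ∈ range k, frameLin L (avgIter L W m) (ψ m) (((L : ℤ) ^ (k - m)) • z)‖ ^ 2
        ≤ (16 * ((d : ℝ) * (L : ℝ) ^ 2) * b) ^ 2 * ((∑ m ∈ range k, (L : ℝ) ^ m) * ∑ m ∈ range k, (L : ℝ) ^ m * SQ m z) := by
    intro z
    have h := norm_mlog_vcov_sub_sum_frameLin_le_supCapped hL k hWu hα hα3' hα4' h52 hb hX hsmall hc₃' h44 z
    change ‖mlog ((vcov L W (relPert W X) k z : (Matrix n n ℂ)ˣ) : Matrix n n ℂ) - ∑ m ∈ range k, frameLin L (avgIter L W m) (ψ m) (((L : ℤ) ^ (k - m)) • z)‖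
        ≤ 16 * ((d : ℝ) * (L : ℝ) ^ 2) * b * ∑ m ∈ range k, (L : ℝ) ^ m * PA m z at h
    have h0 : 0 ≤ 16 * ((d : ℝ) * (L : ℝ) ^ 2) * b * ∑ m ∈ range k, (L : ℝ) ^ m * PA m z :=
      mul_nonneg (by positivity) (Finset.sum_nonneg fun m _ => mul_nonneg (by positivity) (hPA0 m z))
    have h1 := pow_le_pow_left₀ (norm_nonneg _) h 2
    -- Cauchy–Schwarz: `(Σ L^m PA_m)² ≤ (Σ L^m)(Σ L^m PA_m²)`
    have hcs : (∑ m ∈ range k, (L : ℝ) ^ m * PA m z) ^ 2 ≤ (∑ m ∈ range k, (L : ℝ) ^ m) * ∑ m ∈ range k, (L : ℝ) ^ m * PA m z ^ 2 := by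
      have h := Finset.sum_mul_sq_le_sq_mul_sq (range k) (fun m => Real.sqrt ((L : ℝ) ^ m)) (fun m => Real.sqrt ((L : ℝ) ^ m) * PA m z)
      have hs : ∀ m, Real.sqrt ((L : ℝ) ^ m) ^ 2 = (L : ℝ) ^ m := fun m => Real.sq_sqrt (by positivity)
      have e1 : ∑ m ∈ range k, Real.sqrt ((L : ℝ) ^ m) * (Real.sqrt ((L : ℝ) ^ m) * PA m z) = ∑ m ∈ range k, (L : ℝ) ^ m * PA m z :=
        Finset.sum_congr rfl fun m _ => by rw [← mul_assoc, ← sq, hs]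
      have e2 : ∑ m ∈ range k, Real.sqrt ((L : ℝ) ^ m) ^ 2 = ∑ m ∈ range k, (L : ℝ) ^ m := Finset.sum_congr rfl fun m _ => hs m
      have e3 : ∑ m ∈ range k, (Real.sqrt ((L : ℝ) ^ m) * PA m z) ^ 2 = ∑ m ∈ range k, (L : ℝ) ^ m * PA m z ^ 2 :=
        Finset.sum_congr rfl fun m _ => by rw [mul_pow, hs]
      rw [e1, e2, e3] at h
      exact h
    -- Jensen per level
    have hj : ∑ m ∈ range k, (L : ℝ) ^ m * PA m z ^ 2 ≤ ∑ m ∈ range k, (L : ℝ) ^ m * SQ m z :=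
      Finset.sum_le_sum fun m _ => mul_le_mul_of_nonneg_left (pathAvg_sq_le_sqAvg hL1 _) (by positivity)
    have hsum0 : 0 ≤ ∑ m ∈ range k, (L : ℝ) ^ m := Finset.sum_nonneg fun m _ => by positivity
    calc ‖mlog ((vcov L W (relPert W X) k z : (Matrix n n ℂ)ˣ) : Matrix n n ℂ) - ∑ m ∈ range k, frameLin L (avgIter L W m) (ψ m) (((L : ℤ) ^ (k - m)) • z)‖ ^ 2
        ≤ (16 * ((d : ℝ) * (L : ℝ) ^ 2) * b * ∑ m ∈ range k, (L : ℝ) ^ m * PA m z) ^ 2 := h1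
      _ = (16 * ((d : ℝ) * (L : ℝ) ^ 2) * b) ^ 2 * (∑ m ∈ range k, (L : ℝ) ^ m * PA m z) ^ 2 := by ring
      _ ≤ (16 * ((d : ℝ) * (L : ℝ) ^ 2) * b) ^ 2 * ((∑ m ∈ range k, (L : ℝ) ^ m) * ∑ m ∈ range k, (L : ℝ) ^ m * SQ m z) :=
          mul_le_mul_of_nonneg_left (hcs.trans (mul_le_mul_of_nonneg_left hj hsum0)) (by positivity)
  -- sum over the corners, level by level (§2)
  have hlev : ∀ m ∈ range k, ∑ z ∈ periodBox (d := d) N, SQ m z ≤ 16 * ((d : ℝ) * L) * ρ2 ^ m * E := by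
    intro m hm
    have hmj : m ≤ j := by have := Finset.mem_range.mp hm; omega
    exact sum_corners_sqAvg_le hL hN j hWu hWP hx hsm hWx hα hα3 hα4 h52 hb hX hXP hsmall hc₃ hK hmj
  have hsumL : ∑ m ∈ range k, (L : ℝ) ^ m ≤ (L : ℝ) ^ k := sum_pow_le_pow hLR k
  calc ∑ z ∈ periodBox (d := d) N,
          ‖mlog ((vcov L W (relPert W X) k z : (Matrix n n ℂ)ˣ) : Matrix n n ℂ) - ∑ m ∈ range k, frameLin L (avgIter L W m) (ψ m) (((L : ℤ) ^ (k - m)) • z)‖ ^ 2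
      ≤ ∑ z ∈ periodBox (d := d) N, (16 * ((d : ℝ) * (L : ℝ) ^ 2) * b) ^ 2 * ((∑ m ∈ range k, (L : ℝ) ^ m) * ∑ m ∈ range k, (L : ℝ) ^ m * SQ m z) :=
        Finset.sum_le_sum fun z _ => hpt z
    _ = (16 * ((d : ℝ) * (L : ℝ) ^ 2) * b) ^ 2 * (∑ m ∈ range k, (L : ℝ) ^ m) * ∑ m ∈ range k, (L : ℝ) ^ m * ∑ z ∈ periodBox (d := d) N, SQ m z := by
        have e1 : ∑ z ∈ periodBox (d := d) N, (16 * ((d : ℝ) * (L : ℝ) ^ 2) * b) ^ 2 * ((∑ m ∈ range k, (L : ℝ) ^ m) * ∑ m ∈ range k, (L : ℝ) ^ m * SQ m z)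
            = (16 * ((d : ℝ) * (L : ℝ) ^ 2) * b) ^ 2 * ((∑ m ∈ range k, (L : ℝ) ^ m) * ∑ z ∈ periodBox (d := d) N, ∑ m ∈ range k, (L : ℝ) ^ m * SQ m z) := by
          rw [Finset.mul_sum, Finset.mul_sum]
        have e2 : ∑ z ∈ periodBox (d := d) N, ∑ m ∈ range k, (L : ℝ) ^ m * SQ m z = ∑ m ∈ range k, (L : ℝ) ^ m * ∑ z ∈ periodBox (d := d) N, SQ m z := by
          rw [Finset.sum_comm]
          exact Finset.sum_congr rfl fun m _ => by rw [Finset.mul_sum]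
        rw [e1, e2]; ring
    _ ≤ (16 * ((d : ℝ) * (L : ℝ) ^ 2) * b) ^ 2 * (L : ℝ) ^ k * ∑ m ∈ range k, (L : ℝ) ^ m * (16 * ((d : ℝ) * L) * ρ2 ^ m * E) := by
        have h2 : ∑ m ∈ range k, (L : ℝ) ^ m * ∑ z ∈ periodBox (d := d) N, SQ m z ≤ ∑ m ∈ range k, (L : ℝ) ^ m * (16 * ((d : ℝ) * L) * ρ2 ^ m * E) :=
          Finset.sum_le_sum fun m hm => mul_le_mul_of_nonneg_left (hlev m hm) (by positivity)
        have h20 : 0 ≤ ∑ m ∈ range k, (L : ℝ) ^ m * (16 * ((d : ℝ) * L) * ρ2 ^ m * E) :=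
          Finset.sum_nonneg fun m _ => by positivity
        calc (16 * ((d : ℝ) * (L : ℝ) ^ 2) * b) ^ 2 * (∑ m ∈ range k, (L : ℝ) ^ m) * ∑ m ∈ range k, (L : ℝ) ^ m * ∑ z ∈ periodBox (d := d) N, SQ m z
            ≤ (16 * ((d : ℝ) * (L : ℝ) ^ 2) * b) ^ 2 * (∑ m ∈ range k, (L : ℝ) ^ m) * ∑ m ∈ range k, (L : ℝ) ^ m * (16 * ((d : ℝ) * L) * ρ2 ^ m * E) :=
              mul_le_mul_of_nonneg_left h2 (by positivity)
          _ ≤ (16 * ((d : ℝ) * (L : ℝ) ^ 2) * b) ^ 2 * (L : ℝ) ^ k * ∑ m ∈ range k, (L : ℝ) ^ m * (16 * ((d : ℝ) * L) * ρ2 ^ m * E) :=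
              mul_le_mul_of_nonneg_right (mul_le_mul_of_nonneg_left hsumL (by positivity)) h20
    _ = 4096 * ((d : ℝ) ^ 3 * (L : ℝ) ^ 5) * b ^ 2 * (L : ℝ) ^ k * (∑ m ∈ range k, (L : ℝ) ^ m * ρ2 ^ m) * E := by
        have e : ∑ m ∈ range k, (L : ℝ) ^ m * (16 * ((d : ℝ) * L) * ρ2 ^ m * E) = (16 * ((d : ℝ) * L) * E) * ∑ m ∈ range k, (L : ℝ) ^ m * ρ2 ^ m := by
          rw [Finset.mul_sum]
          exact Finset.sum_congr rfl fun m _ => by ring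
        rw [e]; ring

/-! ## §4 The ℓ¹-over-corners letter of the second-order frame defect (appended, gen 97) -/

/-- Geometric sums with ratio at most one half: `Σ_{m<k} (L⁻¹)^m ≤ 2` for `2 ≤ L`. [folklore] -/
theorem sum_inv_pow_le_two {L : ℝ} (hL : 2 ≤ L) : ∀ k : ℕ, ∑ m ∈ range k, (L⁻¹) ^ m ≤ 2
  | 0 => by simp
  | k + 1 => by
      rw [Finset.sum_range_succ']
      have ih := sum_inv_pow_le_two hL k
      have hL0 : 0 < L := by linarith
      have hinv : L⁻¹ ≤ 1 / 2 := by rw [inv_eq_one_div]; exact one_div_le_one_div_of_le (by norm_num) hL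
      have hinv0 : 0 ≤ L⁻¹ := by positivity
      have e : ∑ m ∈ range k, (L⁻¹) ^ (m + 1) = L⁻¹ * ∑ m ∈ range k, (L⁻¹) ^ m := by
        rw [Finset.mul_sum]; exact Finset.sum_congr rfl fun m _ => by ring
      rw [e, pow_zero]
      nlinarith [mul_le_mul hinv ih (Finset.sum_nonneg fun m _ => pow_nonneg hinv0 m) (by norm_num : (0:ℝ) ≤ 1 / 2)]

/-- **THE SECOND-ORDER FRAME DEFECT SUMMED OVER THE TOP CORNERS (ℓ¹ FORM, PRODUCT BOOKKEEPING)** (same regime as `sum_corners_normSq_defect_le`):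
`Σ_{z∈[0,N)^d} ‖log v_{j+1}(z) − Σ_{m≤j} frameLin L W̄^m ψ_m (L^{j+1−m}•z)‖ ≤ 16·dL·(6·Σ_{m≤j} L^m(L²∕L^d)^m + 2·Σ_{m≤j}(L²∕L^d)^m)·l2sq X` — NO sup factor, N-free; in d = 4 both
level sums are `≤ 2` and the display reads `Σ_z h_z ≤ 256·dL·‖X‖²_{ℓ²}`: the ℓ¹-type letters (the κ-letter of the corner spikes, with its `ε²M⁻⁴` room) book this directly (memo ROAD-G97 §3;
product form, Cauchy–Schwarz with the weights `L^{∓m}`, Jensen, §2). [folklore] -/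
theorem sum_corners_norm_defect_le [Nonempty n] {L N : ℕ} (hL : 2 ≤ L) (hN : 1 ≤ N) (j : ℕ)
    {W : Site d → Fin d → (Matrix n n ℂ)ˣ} {x : ℝ} (hWu : IsUnitaryCfg W) (hWP : IsPeriodicCfg W ((N * L ^ (j + 1) : ℕ) : ℤ))
    (hx : 0 ≤ x) (hsm : LevelSmall d L j x) (hWx : SmallField W x)
    {α₀ b : ℝ} (hα : 0 < α₀) (hα3 : C0 d * (2 * α₀) ≤ 1 / 3) (hα4 : 4 * (2 * α₀) ≤ c2' d L)
    (h52 : pdev W < α₀ * (((L : ℝ) ^ (j + 1))⁻¹) ^ 2) (hb : 0 ≤ b)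
    {X : Site d → Fin d → Matrix n n ℂ} (hX : ∀ (y : Site d) (κ : Fin d), ‖X y κ‖ ≤ b) (hXP : IsPeriodicDir X ((N * L ^ (j + 1) : ℕ) : ℤ))
    (hsmall : Real.exp (4 * (800 * ((d : ℝ) + 1) ^ 2 * ((d : ℝ) + 4)) * α₀)
      * (1 + 8 * (131072 * ((d : ℝ) + 1) ^ 2) * ((L : ℝ) ^ (j + 1) * b)) ≤ 2)
    (hc₃ : 4 * ((L : ℝ) ^ (j + 1) * b) ≤ c3 d L)
    (hK : 16 * (C1cov d * (L : ℝ) ^ 2 * Real.sqrt (d * (2 * (2 * L) + 1) ^ d)) * (L : ℝ) ^ (j + 1) * b ≤ Real.sqrt ((L : ℝ) ^ 2 / (L : ℝ) ^ d))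
    (h44 : 44 * ((d : ℝ) * L * ((L : ℝ) ^ (j + 1) * b)) ≤ 1) :
    ∑ z ∈ periodBox (d := d) N,
        ‖mlog ((vcov L W (relPert W X) (j + 1) z : (Matrix n n ℂ)ˣ) : Matrix n n ℂ)
          - ∑ m ∈ range (j + 1), frameLin L (avgIter L W m)
              (fun x' μ => Ad (avgIter L W m x' μ)⁻¹ (logCovIter L W (adField W X) m x' μ)) (((L : ℤ) ^ (j + 1 - m)) • z)‖
      ≤ 16 * ((d : ℝ) * L) * (6 * (∑ m ∈ range (j + 1), (L : ℝ) ^ m * ((L : ℝ) ^ 2 / (L : ℝ) ^ d) ^ m)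
          + 2 * ∑ m ∈ range (j + 1), ((L : ℝ) ^ 2 / (L : ℝ) ^ d) ^ m) * l2sq (periodBox (d := d) (N * L ^ (j + 1))) X := by
  letI : CStarAlgebra (Matrix n n ℂ) := {}
  have hL1 : 1 ≤ L := by omega
  have hLR : (2 : ℝ) ≤ L := by exact_mod_cast hL
  have hL0 : (0 : ℝ) < L := by linarith
  have hα3' : C0 d * α₀ ≤ 1 / 3 := by nlinarith [show (0 : ℝ) ≤ C0 d by unfold C0; positivity]
  have hα4' : 4 * α₀ ≤ c2' d L := by linarith
  have hc₃' : 2 * ((L : ℝ) ^ (j + 1) * b) ≤ c3 d L := by nlinarith [pow_pos hL0 (j + 1)]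
  set k : ℕ := j + 1 with hk
  set ψ : ℕ → Site d → Fin d → Matrix n n ℂ := fun m x' μ => Ad (avgIter L W m x' μ)⁻¹ (logCovIter L W (adField W X) m x' μ) with hψ
  set PA : ℕ → Site d → ℝ := fun m z => ((L : ℝ) ^ d)⁻¹ * ∑ r : Fin d → Fin L, lnorm (ψ m) (((L : ℤ) ^ (k - m)) • z) (treeWord (boxVec L r)) with hPA
  set SQ : ℕ → Site d → ℝ := fun m z => ((L : ℝ) ^ d)⁻¹ * ∑ r : Fin d → Fin L, lnorm (ψ m) (((L : ℤ) ^ (k - m)) • z) (treeWord (boxVec L r)) ^ 2 with hSQ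
  set E : ℝ := l2sq (periodBox (d := d) (N * L ^ k)) X with hE
  set ρ2 : ℝ := (L : ℝ) ^ 2 / (L : ℝ) ^ d with hρ2
  have hE0 : 0 ≤ E := l2sq_nonneg _ _
  have hρ0 : 0 ≤ ρ2 := by positivity
  have hSQ0 : ∀ m z, 0 ≤ SQ m z := fun m z => by simp only [hSQ]; exact mul_nonneg (by positivity) (Finset.sum_nonneg fun r _ => sq_nonneg _)
  -- pointwise: the product form, then Cauchy–Schwarz with the weights `L^{∓m}`, then Jensen
  have hpt : ∀ z : Site d,
      ‖mlog ((vcov L W (relPert W X) k z : (Matrix n n ℂ)ˣ) : Matrix n n ℂ) - ∑ m ∈ range k, frameLin L (avgIter L W m) (ψ m) (((L : ℤ) ^ (k - m)) • z)‖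
        ≤ 6 * ∑ m ∈ range k, (L : ℝ) ^ m * SQ m z + 2 * ∑ m ∈ range k, SQ m z := by
    intro z
    have h := NE7AccumulatedFrameDefectLocal.norm_mlog_vcov_sub_sum_frameLin_le_prod hL k hWu hα hα3' hα4' h52 hb hX hsmall hc₃' h44 z
    change ‖mlog ((vcov L W (relPert W X) k z : (Matrix n n ℂ)ˣ) : Matrix n n ℂ) - ∑ m ∈ range k, frameLin L (avgIter L W m) (ψ m) (((L : ℤ) ^ (k - m)) • z)‖
        ≤ 3 * (∑ m ∈ range k, PA m z) ^ 2 + 2 * ∑ m ∈ range k, SQ m z at h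
    -- Cauchy–Schwarz: `(Σ PA_m)² ≤ (Σ L^{-m})(Σ L^m PA_m²) ≤ 2·Σ L^m PA_m²`
    have hcs : (∑ m ∈ range k, PA m z) ^ 2 ≤ (∑ m ∈ range k, ((L : ℝ)⁻¹) ^ m) * ∑ m ∈ range k, (L : ℝ) ^ m * PA m z ^ 2 := by
      have hcs0 := Finset.sum_mul_sq_le_sq_mul_sq (range k) (fun m => Real.sqrt (((L : ℝ)⁻¹) ^ m)) (fun m => Real.sqrt ((L : ℝ) ^ m) * PA m z)
      have hs1 : ∀ m, Real.sqrt (((L : ℝ)⁻¹) ^ m) ^ 2 = ((L : ℝ)⁻¹) ^ m := fun m => Real.sq_sqrt (by positivity)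
      have hs2 : ∀ m, Real.sqrt ((L : ℝ) ^ m) ^ 2 = (L : ℝ) ^ m := fun m => Real.sq_sqrt (by positivity)
      have hprod : ∀ m, Real.sqrt (((L : ℝ)⁻¹) ^ m) * Real.sqrt ((L : ℝ) ^ m) = 1 := fun m => by
        rw [← Real.sqrt_mul (by positivity), ← mul_pow, inv_mul_cancel₀ (ne_of_gt hL0), one_pow, Real.sqrt_one]
      have e1 : ∑ m ∈ range k, Real.sqrt (((L : ℝ)⁻¹) ^ m) * (Real.sqrt ((L : ℝ) ^ m) * PA m z) = ∑ m ∈ range k, PA m z :=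
        Finset.sum_congr rfl fun m _ => by rw [← mul_assoc, hprod, one_mul]
      have e2 : ∑ m ∈ range k, Real.sqrt (((L : ℝ)⁻¹) ^ m) ^ 2 = ∑ m ∈ range k, ((L : ℝ)⁻¹) ^ m := Finset.sum_congr rfl fun m _ => hs1 m
      have e3 : ∑ m ∈ range k, (Real.sqrt ((L : ℝ) ^ m) * PA m z) ^ 2 = ∑ m ∈ range k, (L : ℝ) ^ m * PA m z ^ 2 :=
        Finset.sum_congr rfl fun m _ => by rw [mul_pow, hs2]
      rw [e1, e2, e3] at hcs0
      exact hcs0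
    have hj : ∑ m ∈ range k, (L : ℝ) ^ m * PA m z ^ 2 ≤ ∑ m ∈ range k, (L : ℝ) ^ m * SQ m z :=
      Finset.sum_le_sum fun m _ => mul_le_mul_of_nonneg_left (pathAvg_sq_le_sqAvg hL1 _) (by positivity)
    have hw0 : 0 ≤ ∑ m ∈ range k, (L : ℝ) ^ m * SQ m z := Finset.sum_nonneg fun m _ => mul_nonneg (by positivity) (hSQ0 m z)
    have hgeo := sum_inv_pow_le_two hLR k
    have hsq : (∑ m ∈ range k, PA m z) ^ 2 ≤ 2 * ∑ m ∈ range k, (L : ℝ) ^ m * SQ m z :=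
      hcs.trans ((mul_le_mul_of_nonneg_left hj (Finset.sum_nonneg fun m _ => by positivity)).trans (mul_le_mul_of_nonneg_right hgeo hw0))
    linarith
  -- sum over the corners, level by level (§2)
  have hlev : ∀ m ∈ range k, ∑ z ∈ periodBox (d := d) N, SQ m z ≤ 16 * ((d : ℝ) * L) * ρ2 ^ m * E := by
    intro m hm
    have hmj : m ≤ j := by have := Finset.mem_range.mp hm; omega
    exact sum_corners_sqAvg_le hL hN j hWu hWP hx hsm hWx hα hα3 hα4 h52 hb hX hXP hsmall hc₃ hK hmj
  have hsum1 : ∑ z ∈ periodBox (d := d) N, ∑ m ∈ range k, (L : ℝ) ^ m * SQ m z ≤ ∑ m ∈ range k, (L : ℝ) ^ m * (16 * ((d : ℝ) * L) * ρ2 ^ m * E) := by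
    rw [Finset.sum_comm]
    refine Finset.sum_le_sum fun m hm => ?_
    rw [← Finset.mul_sum]
    exact mul_le_mul_of_nonneg_left (hlev m hm) (by positivity)
  have hsum2 : ∑ z ∈ periodBox (d := d) N, ∑ m ∈ range k, SQ m z ≤ ∑ m ∈ range k, 16 * ((d : ℝ) * L) * ρ2 ^ m * E := by
    rw [Finset.sum_comm]
    exact Finset.sum_le_sum fun m hm => hlev m hm
  have e1 : ∑ m ∈ range k, (L : ℝ) ^ m * (16 * ((d : ℝ) * L) * ρ2 ^ m * E) = 16 * ((d : ℝ) * L) * E * ∑ m ∈ range k, (L : ℝ) ^ m * ρ2 ^ m := by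
    rw [Finset.mul_sum]; exact Finset.sum_congr rfl fun m _ => by ring
  have e2 : ∑ m ∈ range k, 16 * ((d : ℝ) * L) * ρ2 ^ m * E = 16 * ((d : ℝ) * L) * E * ∑ m ∈ range k, ρ2 ^ m := by
    rw [Finset.mul_sum]; exact Finset.sum_congr rfl fun m _ => by ring
  calc ∑ z ∈ periodBox (d := d) N,
          ‖mlog ((vcov L W (relPert W X) k z : (Matrix n n ℂ)ˣ) : Matrix n n ℂ) - ∑ m ∈ range k, frameLin L (avgIter L W m) (ψ m) (((L : ℤ) ^ (k - m)) • z)‖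
      ≤ ∑ z ∈ periodBox (d := d) N, (6 * ∑ m ∈ range k, (L : ℝ) ^ m * SQ m z + 2 * ∑ m ∈ range k, SQ m z) := Finset.sum_le_sum fun z _ => hpt z
    _ = 6 * ∑ z ∈ periodBox (d := d) N, ∑ m ∈ range k, (L : ℝ) ^ m * SQ m z + 2 * ∑ z ∈ periodBox (d := d) N, ∑ m ∈ range k, SQ m z := by
        rw [Finset.sum_add_distrib, ← Finset.mul_sum, ← Finset.mul_sum]
    _ ≤ 6 * (16 * ((d : ℝ) * L) * E * ∑ m ∈ range k, (L : ℝ) ^ m * ρ2 ^ m) + 2 * (16 * ((d : ℝ) * L) * E * ∑ m ∈ range k, ρ2 ^ m) := by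
        rw [← e1, ← e2]; exact add_le_add (mul_le_mul_of_nonneg_left hsum1 (by norm_num)) (mul_le_mul_of_nonneg_left hsum2 (by norm_num))
    _ = 16 * ((d : ℝ) * L) * (6 * (∑ m ∈ range k, (L : ℝ) ^ m * ρ2 ^ m) + 2 * ∑ m ∈ range k, ρ2 ^ m) * E := by ring

end

end Summit.QuantumFields.BalabanUV.T4Continuum.NE7AccumulatedFrameDefectCornerSums
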